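import Summits.CriticalPhenomena.CardyFormulaZ2.Theses.CardySelfRefinement
import Summits.CriticalPhenomena.CardyFormulaZ2.Theses.CardyMaterialLaw
import Literature.Probability.Percolation.QuadCrossingSubseqLimits
import Literature.Probability.Percolation.QuadCrossingRotationCoupling
import Literature.Probability.Distributions.WeakLimitCouplingTransfer
import Mathlib.Analysis.SpecialFunctions.Complex.Circle
import HarnessLib

/-!
# `RotationInput` (stmt-CriticalPhenomena-10270) from DKKMO's Theorem 1.2 (Schramm–Smirnov half)

Item `RotationInput` of routes `CardySelfRefinement` / `CardyMaterialLaw` (sub-problem `CardyFormulaZ2`):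
every subsequential scaling limit `μ ∈ subseqQuadLimits univ` of critical bond percolation on `δℤ²`
in the Schramm–Smirnov space `ℋ_ℂ` is invariant under every rotation,
`isometryLaw (rotation e^{iα}) μ = μ` for all real `α` — the "ℋ-form" of the rotation invariance
theorem of Duminil-Copin–Kozlowski–Krachun–Manolescu–Oulamara (arXiv:2012.11672, Thm. 1.2).

This file proves the ℋ-space passage completely and leaves exactly the printed theorem as the
input: `rotationInput_of_dkkmo_theorem_1_2_schrammSmirnov : dkkmo_theorem_1_2_schrammSmirnov →
RotationInput`, where the named fact `dkkmo_theorem_1_2_schrammSmirnov`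
(`Literature/Probability/Percolation/QuadCrossingRotationCoupling.lean`) is DKKMO's Theorem 1.2,
`d_SS` part, at `q = 1` and `Ω = ℝ²` (§1.3: "by taking the limit as `Ω` tends to `ℝ²` … we also
obtain the statement for the unique infinite-volume measure"; proof §7.1, "Case of `Ω = ℝ²`",
p. 42): for `ε > 0` there is `δ₀ > 0` such that for all `α ∈ (ε, π - ε)` and `δ ≤ δ₀` some coupling
`ℙ` of `ω_δ, ω'_δ ∼ P_{1/2}` on `δℤ²` has `ℙ[d_SS(ω_δ, e^{iα} ω'_δ) > ε] < ε`.  It is rendered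
metric-free ("`d_SS`, the metric whose definition is implicit", §1.2 p. 4): `ℙ[(S_{ω_δ},
e^{iα}·S_{ω'_δ}) ∉ N] < ε` for every open neighbourhood `N` of the diagonal of `ℋ_ℂ × ℋ_ℂ`
(equivalent to the printed form for ANY metric inducing the topology, `ℋ_ℂ` being compact
metrizable — Schramm–Smirnov Thm. 1.4, proved in the tree), VERBATIM the hypothesis `hSS` of the
tree's `dkkmo_crossing_rotation_invariance_of_schrammSmirnov` (so the same fact also feeds the
per-quad Corollary 1.3).

STATUS: CONDITIONAL — the trust base of `rotationInput_of_dkkmo_theorem_1_2_schrammSmirnov` (and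
of the `CardyMaterialLaw` twin `materialLaw_rotationInput_of_…`) is exactly
`{dkkmo_theorem_1_2_schrammSmirnov}`, the published rotation-invariance theorem itself (DKKMO's
main theorem; discharging it = formalising arXiv:2012.11672).  `rotationInput_of_dist` takes the
printed metric form instead (any jointly continuous `d` on `ℋ_ℂ` positive off the diagonal).

## Proof (no continuity of crossing events, no `π`-system argument)

* `FiniteMeasure.tendsto_of_forall_coupling` (`Literature/Probability/Distributions/
  WeakLimitCouplingTransfer.lean`, Billingsley's "convergence together" in metric-free coupling
  form): if `μs i → μ` weakly and for every open measurable neighbourhood `N` of the diagonal and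
  `ε > 0`, eventually some coupling `π` of `(μs i, νs i)` has `π(Nᶜ) ≤ ε`, then `νs i → μ`.
* `map_rotate_eq_of_mem_subseqQuadLimits` — for `θ ∈ (0, π)`: along the defining meshes
  `δₖ → 0`, `μ_{δₖ} → μ`; the rotated laws `(e^{iθ}·)_* μ_{δₖ}` tend to `(e^{iθ}·)_* μ` (continuity
  of push-forward along the homeomorphism `e^{iθ}·` of `ℋ_ℂ`) and, by the fact and the coupling
  transfer, also to `μ`; limits are unique (`ℋ_ℂ` metrizable ⇒ `FiniteMeasure ℋ_ℂ` Hausdorff).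
* all angles: the stabiliser `{θ | (e^{iθ}·)_* μ = μ}` is closed under addition
  (`rotate_add`) and `2π`-periodic; it contains `(0, π)`, hence `(0, ∞)` (`t = m · (t/m)`), hence
  `ℝ`.  Finally `isometryLaw (rotation e^{iα}) = (·).map (rotate α)`.

## References

* [DKKMO2020Rotational] H. Duminil-Copin, K. K. Kozlowski, D. Krachun, I. Manolescu, M. Oulamara,
  *Rotational invariance in critical planar lattice models*, arXiv:2012.11672v1: §1.2 p. 4 (`ℋ`,
  `d_SS`), Thm. 1.2 p. 5, §1.3 (infinite volume), §7.1 p. 42 (proof, case `Ω = ℝ²`).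
* [SchrammSmirnov2011] O. Schramm, S. Smirnov, Ann. Probab. 39 (2011), §1.3–1.4, Thm. 1.4,
  Cor. 1.6.
* [Tassion2024] V. Tassion, Sém. Bourbaki Exp. 1210 (the `q = 1` case).
-/

noncomputable section

open MeasureTheory Filter Set Topology
open scoped BoundedContinuousFunction ENNReal NNReal
open Literature.Probability.Percolation Literature.Probability.LatticeModels
open Literature.Probability.Percolation.QuadCrossing

namespace Summit.CriticalPhenomena.CardyFormulaZ2.Theorems

/-! ### Rotations of `ℋ_ℂ`: bookkeeping -/

/-- `e^{i(a+b)}· = e^{ia}· ∘ e^{ib}·` on `ℋ_ℂ`. -/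
theorem rotate_add (a b : ℝ) :
    QuadConfig.rotate (a + b) = QuadConfig.rotate a ∘ QuadConfig.rotate b := by
  funext S
  have h : (rotation (Circle.exp (a + b))).toHomeomorph =
      ((rotation (Circle.exp b)).toHomeomorph).trans ((rotation (Circle.exp a)).toHomeomorph) := by
    refine Homeomorph.ext fun z => ?_
    show rotation (Circle.exp (a + b)) z = rotation (Circle.exp a) (rotation (Circle.exp b) z)
    rw [rotation_apply, rotation_apply, rotation_apply, Circle.exp_add, Circle.coe_mul, mul_assoc]
  show S.mapHomeomorph _ = (S.mapHomeomorph _).mapHomeomorph _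
  rw [h, QuadConfig.mapHomeomorph_trans]

/-- `e^{i(θ + n·2π)}· = e^{iθ}·` on `ℋ_ℂ`. -/
theorem rotate_add_nat_mul_two_pi (θ : ℝ) (n : ℕ) :
    QuadConfig.rotate (θ + n * (2 * Real.pi)) = QuadConfig.rotate θ := by
  unfold QuadConfig.rotate
  rw [Circle.periodic_exp.nat_mul n θ]

/-- The motion of `ℋ_ℂ` by the rotation `z ↦ e^{iα} z` as a Euclidean isometry is
`QuadConfig.rotate α`. -/
theorem isometry_rotation_eq_rotate (α : ℝ) :
    QuadConfig.isometry (rotation (Circle.exp α)).toIsometryEquiv = QuadConfig.rotate α := by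
  have h : (rotation (Circle.exp α)).toIsometryEquiv.toHomeomorph =
      (rotation (Circle.exp α)).toHomeomorph :=
    Homeomorph.ext fun _ => rfl
  unfold QuadConfig.isometry QuadConfig.rotate
  rw [h]

/-- `isometryLaw (rotation e^{iα}) μ = μ.map (rotate α)`. -/
theorem isometryLaw_rotation_eq_map_rotate (α : ℝ)
    (μ : FiniteMeasure (QuadConfig (univ : Set ℂ))) :
    isometryLaw (rotation (Circle.exp α)).toIsometryEquiv μ = μ.map (QuadConfig.rotate α) := by
  unfold isometryLaw
  rw [isometry_rotation_eq_rotate]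

/-- The set of angles stabilising a law on `ℋ_ℂ` is closed under addition. -/
theorem map_rotate_add_eq {μ : Measure (QuadConfig (univ : Set ℂ))} {a b : ℝ}
    (ha : μ.map (QuadConfig.rotate a) = μ) (hb : μ.map (QuadConfig.rotate b) = μ) :
    μ.map (QuadConfig.rotate (a + b)) = μ := by
  rw [rotate_add, ← Measure.map_map (QuadConfig.measurable_rotate a) (QuadConfig.measurable_rotate b),
    hb, ha]

/-- Positive multiples: invariance under `e^{is}·` gives invariance under `e^{i(m+1)s}·`. -/
theorem map_rotate_nat_succ_mul_eq {μ : Measure (QuadConfig (univ : Set ℂ))} {s : ℝ}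
    (hs : μ.map (QuadConfig.rotate s) = μ) (m : ℕ) :
    μ.map (QuadConfig.rotate ((m + 1 : ℕ) * s)) = μ := by
  induction m with
  | zero => simpa using hs
  | succ m ih =>
    have : ((m + 1 + 1 : ℕ) : ℝ) * s = ((m + 1 : ℕ) : ℝ) * s + s := by push_cast; ring
    rw [this]
    exact map_rotate_add_eq ih hs

/-- **From `(0, π)` to all angles.**  If a law on `ℋ_ℂ` is invariant under `e^{iθ}·` for every
`θ ∈ (0, π)`, it is invariant under every rotation: a positive `t` is `m · (t/m)` with
`t/m ∈ (0, π)`, and a general `α` is congruent modulo `2π` to a positive angle. -/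
theorem map_rotate_eq_of_forall_Ioo {μ : Measure (QuadConfig (univ : Set ℂ))}
    (h : ∀ θ ∈ Set.Ioo 0 Real.pi, μ.map (QuadConfig.rotate θ) = μ) (α : ℝ) :
    μ.map (QuadConfig.rotate α) = μ := by
  -- positive angles
  have hposang : ∀ t : ℝ, 0 < t → μ.map (QuadConfig.rotate t) = μ := by
    intro t ht
    obtain ⟨m, hm⟩ := exists_nat_gt (t / Real.pi)
    have hmpos : 0 < (m : ℝ) := lt_trans (div_pos ht Real.pi_pos) hm
    have hm1 : 1 ≤ m := Nat.one_le_iff_ne_zero.2 (by rintro rfl; simp at hmpos)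
    set s : ℝ := t / m with hs
    have hs0 : 0 < s := div_pos ht hmpos
    have hsπ : s < Real.pi := by
      rw [hs, div_lt_iff₀ hmpos]
      calc t = (t / Real.pi) * Real.pi := by field_simp
        _ < m * Real.pi := mul_lt_mul_of_pos_right hm Real.pi_pos
        _ = Real.pi * m := mul_comm _ _
    have hts : t = ((m - 1 + 1 : ℕ) : ℝ) * s := by
      rw [Nat.sub_add_cancel hm1, hs]; field_simp
    rw [hts]
    exact map_rotate_nat_succ_mul_eq (h s ⟨hs0, hsπ⟩) (m - 1)
  -- general angle: shift by a multiple of `2π`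
  obtain ⟨n, hn⟩ := exists_nat_gt (-α / (2 * Real.pi))
  have h2π : 0 < 2 * Real.pi := by positivity
  have hpos' : 0 < α + n * (2 * Real.pi) := by
    have : -α < n * (2 * Real.pi) := by rwa [div_lt_iff₀ h2π] at hn
    linarith
  rw [← rotate_add_nat_mul_two_pi α n]
  exact hposang _ hpos'

/-! ### The ℋ-space passage -/

/-- **One angle in `(0, π)`.**  Under DKKMO's Theorem 1.2 (`d_SS` half, `q = 1`, plane), every
subsequential scaling limit `μ` of critical bond percolation on `δℤ²` in `ℋ_ℂ` is invariant under
the rotation `e^{iθ}·` for `θ ∈ (0, π)`: along the defining meshes `δₖ → 0⁺` the laws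
`μ_{δₖ} → μ`, their rotations `(e^{iθ}·)_* μ_{δₖ} → (e^{iθ}·)_* μ` (continuity of the push-forward
along the homeomorphism `e^{iθ}·`), and also `→ μ` by the coupling transfer
(`FiniteMeasure.tendsto_of_forall_coupling`, the couplings of the theorem pushed forward to
`ℋ_ℂ × ℋ_ℂ`); weak limits on the metrizable `ℋ_ℂ` (Schramm–Smirnov Thm. 1.4) are unique. -/
theorem map_rotate_eq_of_mem_subseqQuadLimits (hSS : dkkmo_theorem_1_2_schrammSmirnov)
    {μ : FiniteMeasure (QuadConfig (univ : Set ℂ))} (hμ : μ ∈ subseqQuadLimits (univ : Set ℂ))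
    {θ : ℝ} (hθ : θ ∈ Set.Ioo 0 Real.pi) :
    μ.map (QuadConfig.rotate θ) = μ := by
  -- `ℋ_ℂ` is metrizable Hausdorff (Schramm–Smirnov Thm. 1.4), so weak limits are unique
  haveI : T2Space (QuadConfig (univ : Set ℂ)) :=
    (SchrammSmirnov2011_thm_1_4_holds univ isOpen_univ univ_nonempty).1.2.2
  haveI : TopologicalSpace.MetrizableSpace (QuadConfig (univ : Set ℂ)) :=
    (SchrammSmirnov2011_thm_1_4_holds univ isOpen_univ univ_nonempty).1.2.1
  -- the defining meshes
  obtain ⟨δs, hpos, hδ0, hlim⟩ := (isSubseqQuadLimit_iff univ μ).1 hμ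
  set R : QuadConfig (univ : Set ℂ) → QuadConfig (univ : Set ℂ) := QuadConfig.rotate θ with hR
  have hRcont : Continuous R := QuadConfig.continuous_mapHomeomorph _
  have hRmeas : Measurable R := QuadConfig.measurable_rotate θ
  -- the rotated laws tend to the rotated limit …
  have hrot : Tendsto (fun k => (z2QuadLaw univ (δs k)).map R) atTop (𝓝 (μ.map R)) :=
    FiniteMeasure.tendsto_map_of_tendsto_of_continuous _ _ hlim hRcont
  -- … and to the limit itself, by the coupling transfer
  have hrot' : Tendsto (fun k => (z2QuadLaw univ (δs k)).map R) atTop (𝓝 μ) := by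
    refine FiniteMeasure.tendsto_of_forall_coupling hlim fun N hNopen hNmeas hNdiag ε hε => ?_
    -- shrink `ε` so that `θ ∈ (ε', π - ε')`
    set ε' : ℝ := min ε (min θ (Real.pi - θ)) / 2 with hε'
    have hmin : 0 < min ε (min θ (Real.pi - θ)) := lt_min hε (lt_min hθ.1 (sub_pos.2 hθ.2))
    have hε'pos : 0 < ε' := by positivity
    have hε'ε : ε' ≤ ε := by
      have : min ε (min θ (Real.pi - θ)) ≤ ε := min_le_left _ _
      rw [hε']; linarith
    have hθ' : θ ∈ Set.Ioo ε' (Real.pi - ε') := by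
      have h1 : min ε (min θ (Real.pi - θ)) ≤ θ := (min_le_right _ _).trans (min_le_left _ _)
      have h2 : min ε (min θ (Real.pi - θ)) ≤ Real.pi - θ :=
        (min_le_right _ _).trans (min_le_right _ _)
      exact ⟨by rw [hε']; linarith, by rw [hε']; linarith⟩
    obtain ⟨δ₀, hδ₀, hcoup⟩ := hSS ε' hε'pos N hNopen hNdiag
    have hev : ∀ᶠ k in atTop, δs k < δ₀ := hδ0.eventually (gt_mem_nhds hδ₀)
    filter_upwards [hev] with k hk
    obtain ⟨P, hP1, hP2, hPN⟩ := hcoup θ hθ' (δs k) (hpos k) hk.le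
    -- push the coupling forward to `ℋ_ℂ × ℋ_ℂ`
    set S : BondConfig (Site 2) → QuadConfig (univ : Set ℂ) := z2QuadConfig univ (δs k) with hS
    have hSmeas : Measurable S := measurable_z2QuadConfig isOpen_univ (hpos k)
    set F : BondConfig (Site 2) × BondConfig (Site 2) →
        QuadConfig (univ : Set ℂ) × QuadConfig (univ : Set ℂ) := fun p => (S p.1, R (S p.2)) with hF
    have hFmeas : Measurable F :=
      (hSmeas.comp measurable_fst).prodMk (hRmeas.comp (hSmeas.comp measurable_snd))
    refine ⟨P.map F, ?_, ?_, ?_⟩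
    · rw [Measure.map_map measurable_fst hFmeas,
        show Prod.fst ∘ F = S ∘ Prod.fst from rfl, ← Measure.map_map hSmeas measurable_fst, hP1]
      rfl
    · rw [Measure.map_map measurable_snd hFmeas,
        show Prod.snd ∘ F = (R ∘ S) ∘ Prod.snd from rfl, ← Measure.map_map (hRmeas.comp hSmeas)
          measurable_snd, hP2, ← Measure.map_map hRmeas hSmeas]
      rfl
    · rw [Measure.map_apply hFmeas hNmeas.compl]
      exact (hPN.le.trans (ENNReal.ofReal_le_ofReal hε'ε))
  exact tendsto_nhds_unique hrot hrot'

/-- **`RotationInput` from DKKMO's Theorem 1.2** (route `CardySelfRefinement`,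
stmt-CriticalPhenomena-10270): every subsequential quad-crossing limit of critical bond
percolation on `ℤ²` over the whole plane is invariant under all rotations,
`isometryLaw (rotation e^{iα}) μ = μ`.  CONDITIONAL on the named fact
`dkkmo_theorem_1_2_schrammSmirnov` (DKKMO arXiv:2012.11672 Thm. 1.2, `d_SS` part, `q = 1`,
`Ω = ℝ²`), the published rotation-invariance theorem itself; everything else (the ℋ-space
passage and the angle bookkeeping) is proved above. -/
theorem rotationInput_of_dkkmo_theorem_1_2_schrammSmirnov
    (hSS : dkkmo_theorem_1_2_schrammSmirnov) :
    Summit.CriticalPhenomena.CardyFormulaZ2.Theses.CardySelfRefinement.RotationInput := by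
  intro μ hμ α
  rw [isometryLaw_rotation_eq_map_rotate]
  apply FiniteMeasure.toMeasure_injective
  rw [FiniteMeasure.toMeasure_map]
  exact map_rotate_eq_of_forall_Ioo (fun θ hθ => by
    have h := congrArg FiniteMeasure.toMeasure (map_rotate_eq_of_mem_subseqQuadLimits hSS hμ hθ)
    rwa [FiniteMeasure.toMeasure_map] at h) α

/-- **The same item as wanted by route `CardyMaterialLaw`** (its decl `RotationInput` has the
identical statement): conditional on `dkkmo_theorem_1_2_schrammSmirnov`. -/
theorem materialLaw_rotationInput_of_dkkmo_theorem_1_2_schrammSmirnov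
    (hSS : dkkmo_theorem_1_2_schrammSmirnov) :
    Summit.CriticalPhenomena.CardyFormulaZ2.Theses.CardyMaterialLaw.RotationInput :=
  rotationInput_of_dkkmo_theorem_1_2_schrammSmirnov hSS

/-! ### From the printed (metric) form -/

/-- **`RotationInput` from the printed (metric) form of DKKMO's Theorem 1.2**, for any jointly
continuous `d` on `ℋ_ℂ` positive off the diagonal (in particular any metric inducing `𝒯`):
`dkkmo_theorem_1_2_schrammSmirnov_of_dist` then `rotationInput_of_dkkmo_theorem_1_2_schrammSmirnov`. -/
theorem rotationInput_of_dist
    (d : QuadCrossingSpace (univ : Set ℂ) → QuadCrossingSpace (univ : Set ℂ) → ℝ)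
    (hdc : Continuous fun p : QuadCrossingSpace (univ : Set ℂ) × QuadCrossingSpace (univ : Set ℂ) =>
      d p.1 p.2)
    (hdpos : ∀ S S', S ≠ S' → 0 < d S S')
    (hSSd : ∀ ε : ℝ, 0 < ε → ∃ δ₀ : ℝ, 0 < δ₀ ∧ ∀ α ∈ Set.Ioo ε (Real.pi - ε), ∀ δ : ℝ, 0 < δ →
      δ ≤ δ₀ → ∃ P : Measure (BondConfig (Site 2) × BondConfig (Site 2)),
        P.map Prod.fst = bondPercolation (zdGraph 2) half ∧
        P.map Prod.snd = bondPercolation (zdGraph 2) half ∧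
        P {p | ε < d (z2QuadConfig univ δ p.1) (QuadConfig.rotate α (z2QuadConfig univ δ p.2))} <
          ENNReal.ofReal ε) :
    Summit.CriticalPhenomena.CardyFormulaZ2.Theses.CardySelfRefinement.RotationInput :=
  rotationInput_of_dkkmo_theorem_1_2_schrammSmirnov
    (dkkmo_theorem_1_2_schrammSmirnov_of_dist d hdc hdpos hSSd)

end Summit.CriticalPhenomena.CardyFormulaZ2.Theorems

end
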